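/-
Copyright: the b2b-balaban T⁴-continuum CRUX team, row NE7b owner lineage `t4-ne7b-p1` (gen 111). Project licence.
-/
import Mathlib.Analysis.InnerProductSpace.PiL2
import Mathlib.Topology.Algebra.Module.FiniteDimension
import Literature.MathematicalPhysics.QuantumFieldTheory.Balaban1983to89.B4Ineq115Torus

/-!
# THE HARD-STEP CELL's NORMED-SPACE LETTERS ARE INHABITED BY BAŁABAN's SCALAR SOFT TOWER AT EVERY LEVEL: on `EuclideanSpace ℝ (Site P j)` the
# effective form `Δ^{(j)}` (`B5Display136Torus.Drs`) IS a continuous bilinear form `R` and the next averaging `Q_j` IS a continuous linear map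
# `D`, with `0 ≤ R x x ≤ a·‖x‖²` for all `x` and `γ_u(L,a)·‖x‖² ≤ R x x` on `ker D` — the `hR` slot of `…DominationTransfer`, the `hco` ∕ ceiling
# slots of `…TransportedFormCoercivity` ∕ `…HardStepTowerBox`, LEVEL-FREE (row NE7b, node U5c; Mathlib + the tree's `B4Ineq115Torus` BY NAME;
# a JUNCTION certificate — nothing new of print's)

Cell `pub-balaban`, sub-cell `t4`, spine estimate NE7b (`T4WeightBudget.RelWeightBound`; the cell's OWN estimate — NOT PRINTED in [Bałaban 1983–89],
NOT PROVED).  Crux-route work under `Spine/NE7b/` by the row OWNER (`t4-ne7b-p1` gen 111) under FREEZE (0)'s crux-prover clause; NOTHING of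
Bałaban's is asserted: every input is a KERNEL theorem of the tree's `B4Ineq115Torus` ∕ `B1RG242Torus` ∕ `B1` (the typed scalar torus tower of
[Balaban1982Higgs1] and the (1.15) bounds of [Balaban1983RegularityDecay], proved there for `U = 1`); no `T4Continuum/Support` leaf typed; no `def`;
zero `sorry`.  Companions (same seat): `…SoftTowerRegionLetters` (the same letters in `dotProduct` currency), `…MatrixFormJunction` (the generic
`Matrix` ∕ `dotProduct` → `EuclideanSpace` transfer); THIS FILE is self-contained over `B4Ineq115Torus` so that it verifies without their oleans.

WHY (owner word W-ne7bp1-g111-2).  The cell's shapes are stated over real normed spaces (`R : F →L[ℝ] F →L[ℝ] ℝ`, `D₂ : F →L[ℝ] G`,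
`hR : ∀ g, D₂ g = 0 → m‖g‖² ≤ R g g`, ceilings `R g g ≤ B‖g‖²`); the tree's by-value theorems for print's scalar tower are in `Matrix` ∕
`dotProduct` currency on `Site P j → ℝ`.  Here the two meet ON PRINT's OWN TOWER OBJECT: at every level `j ≥ 1` the pair `(R, D)` exists as
continuous maps on `EuclideanSpace ℝ (Site P j)` with the MODEL letters BY VALUE and level-free constants `(a, γ_u(L,a))`
(`γ_u = B4Ineq115Torus.gamma115u`, `> 0`), i.e. the hypotheses the shapes consume are NOT EMPTY for Bałaban's soft flow, uniformly in the level.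

WHAT IS PROVED (`P : Params`, `a > 0`, `m² ≥ 0`, `j ≥ 1`; `E := EuclideanSpace ℝ (Site P j)`, `F := EuclideanSpace ℝ (Site P (j+1))`):
* §1 `form_Drs_ker_floor` (`Q_j v = 0 ⟹ γ_u·(v ⬝ᵥ v) ≤ v ⬝ᵥ Δ^{(j)} v` — (1.15)'s argument loses its
  `aL^{−2}Q^*Q` term on `ker Q_j`; `B4Ineq115Torus.ineq115_lower_uniform`).
* §2 **`softTower_letters_CLM`**: `∃ (R : E →L E →L ℝ) (D : E →L F)`, `R x y = x ⬝ᵥ Δ^{(j)} y` ∧ `ofLp (D x) = Q_j x` ∧ `∀ x, 0 ≤ R x x` ∧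
  `∀ x, R x x ≤ a‖x‖²` ∧ `∀ x, D x = 0 → γ_u(L,a)‖x‖² ≤ R x x` ∧ `0 < γ_u(L,a)`.
* §3 toy: the ratio of the two constants at `L = 2`, `0 < a ≤ 8` is `24` (as in `…SoftTowerRegionLetters.ratio_L2`, restated on `γ_u⁻¹·a`).

NOT HERE (honest): the hard flow (`…FreeFieldBlockingLetters`, `ℓ²(ℤ^d)`); covariant `U ≠ 1`; the identification with print's small-field action
((A3) ∕ (A1c), NC-NE7b-α UNRULED).  BY-NAME EFFECT ON THE WALL: NONE.  NE7b NOT PRINTED ∕ NOT PROVED; spine PROVED 0∕9; rung (B)+1 on a FINITE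
torus — NOT infinite volume, NOT the mass gap, NOT Clay.  HONEST DEPENDENCY: continuum YM on T⁴ ⇐ BetaPertH ∧ nine spine estimates (0∕9 proved);
BetaPertH ⇐ (D1) ∧ (D4) ∧ CAP+tail; G-an2-4 gates asym, D1 and NE2∕3∕4.
-/

set_option autoImplicit false

namespace Summit.QuantumFields.BalabanUV.T4Continuum.NE7b.SoftTowerLettersCLM

open Matrix WithLp
open Literature.MathematicalPhysics.QuantumFieldTheory.Balaban1983to89
open B1RG242Torus B5Display136Torus B4Ineq115Torus

variable {P : Params}

/-! ## §1. The kernel floor in `dotProduct` currency -/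

/-- **The floor on `ker Q_j`**: `Q_j v = 0 ⟹ γ_u(L,a)·(v ⬝ᵥ v) ≤ v ⬝ᵥ Δ^{(j)}v` — on the kernel the `aL^{−2}Q^*Q` term of (1.15)'s argument
`Carg` vanishes (`B4Ineq115Torus.ineq115_lower_uniform`). [folklore] -/
theorem form_Drs_ker_floor {a msq : ℝ} (ha : 0 < a) (hm : 0 ≤ msq) {j : ℕ} (hj : 1 ≤ j) (v : Site P j → ℝ)
    (hv : Q P j *ᵥ v = 0) : gamma115u P.L a * (v ⬝ᵥ v) ≤ v ⬝ᵥ (Drs P a msq j *ᵥ v) := by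
  have h := ineq115_lower_uniform ha hm hj v
  have hC : v ⬝ᵥ (Carg P a msq j *ᵥ v) = v ⬝ᵥ (Drs P a msq j *ᵥ v) := by
    rw [Carg, Matrix.add_mulVec, dotProduct_add, Matrix.smul_mulVec, dotProduct_smul, ← Matrix.mulVec_mulVec, hv,
      Matrix.mulVec_zero, dotProduct_zero, smul_zero, zero_add]
  rwa [hC] at h

/-! ## §2. The letters as continuous maps on `EuclideanSpace ℝ (Site P j)` -/

/-- **BAŁABAN's SCALAR SOFT TOWER INHABITS THE NORMED-SPACE LETTERS, LEVEL-FREE.**  For every level `j ≥ 1` there are a continuous bilinear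
form `R` on `EuclideanSpace ℝ (Site P j)` and a continuous linear map `D` to `EuclideanSpace ℝ (Site P (j+1))` — the effective form `Δ^{(j)}`
and the next averaging `Q_j` in coordinates — with `0 ≤ R x x ≤ a·‖x‖²` for all `x`, `γ_u(L,a)·‖x‖² ≤ R x x` on `ker D`, and
`0 < γ_u(L,a)`: the `hR` ∕ `hco` ∕ ceiling slots of the cell's shapes, inhabited with constants independent of `j`. [folklore] -/
theorem softTower_letters_CLM {a msq : ℝ} (ha : 0 < a) (hm : 0 ≤ msq) {j : ℕ} (hj : 1 ≤ j) :
    ∃ (R : EuclideanSpace ℝ (Site P j) →L[ℝ] EuclideanSpace ℝ (Site P j) →L[ℝ] ℝ)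
      (D : EuclideanSpace ℝ (Site P j) →L[ℝ] EuclideanSpace ℝ (Site P (j + 1))),
      (∀ x y, R x y = ofLp x ⬝ᵥ (Drs P a msq j *ᵥ ofLp y)) ∧
      (∀ x, ofLp (D x) = Q P j *ᵥ ofLp x) ∧
      (∀ x, 0 ≤ R x x) ∧
      (∀ x, R x x ≤ a * ‖x‖ ^ 2) ∧
      (∀ x, D x = 0 → gamma115u P.L a * ‖x‖ ^ 2 ≤ R x x) ∧
      0 < gamma115u P.L a := by
  classical
  set R : EuclideanSpace ℝ (Site P j) →L[ℝ] EuclideanSpace ℝ (Site P j) →L[ℝ] ℝ :=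
    (innerSL ℝ).bilinearComp (ContinuousLinearMap.id ℝ _)
      (LinearMap.toContinuousLinearMap (Matrix.toEuclideanLin (𝕜 := ℝ) (Drs P a msq j))) with hRdef
  set D : EuclideanSpace ℝ (Site P j) →L[ℝ] EuclideanSpace ℝ (Site P (j + 1)) :=
    LinearMap.toContinuousLinearMap (Matrix.toEuclideanLin (𝕜 := ℝ) (Q P j)) with hDdef
  have hR : ∀ x y, R x y = ofLp x ⬝ᵥ (Drs P a msq j *ᵥ ofLp y) := fun x y => by
    rw [hRdef, ContinuousLinearMap.bilinearComp_apply, ContinuousLinearMap.id_apply, LinearMap.coe_toContinuousLinearMap']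
    show inner ℝ x _ = _
    rw [EuclideanSpace.inner_eq_star_dotProduct, dotProduct_comm, Matrix.toEuclideanLin, Matrix.toLpLin_apply, WithLp.ofLp_toLp]
    simp
  have hD : ∀ x, ofLp (D x) = Q P j *ᵥ ofLp x := fun x => by
    rw [hDdef, LinearMap.coe_toContinuousLinearMap', Matrix.toEuclideanLin, Matrix.toLpLin_apply]
  have norm_sq_eq_dot : ∀ x : EuclideanSpace ℝ (Site P j), ‖x‖ ^ 2 = ofLp x ⬝ᵥ ofLp x := fun x => by
    rw [EuclideanSpace.norm_sq_eq]; simp [dotProduct, sq]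
  refine ⟨R, D, hR, hD, fun x => ?_, fun x => ?_, fun x hx => ?_, gamma115u_pos ha (one_lt_cast_L P)⟩
  · rw [hR]; exact form_Drs_nonneg ha hm hj _
  · rw [hR, norm_sq_eq_dot]
    exact (form_Drs_le ha hm hj _).trans
      (mul_le_mul_of_nonneg_right (B1.aSeq_le ha (one_lt_cast_L P) j hj) (dot_self_nonneg _))
  · rw [hR, norm_sq_eq_dot]
    refine form_Drs_ker_floor ha hm hj _ ?_
    rw [← hD, hx]; rfl

/-! ## §3. Toy: the two constants' ratio at `L = 2` -/

/-- At `L = 2` and `0 < a ≤ 8` the level-free ratio of the ceiling to the kernel floor is `γ_u(2,a)⁻¹·a = 24`. -/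
example {a : ℝ} (ha : 0 < a) (ha8 : a ≤ 8) : (gamma115u 2 a)⁻¹ * a = 24 := by
  have hmin : min 8 a = a := min_eq_right ha8
  unfold gamma115u
  rw [hmin, inv_inv]
  field_simp
  ring

end Summit.QuantumFields.BalabanUV.T4Continuum.NE7b.SoftTowerLettersCLM
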